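import Mathlib
import Literature.Probability.Percolation.DiagonalStripVertexParity
import Literature.Probability.Percolation.DiagonalStripQKZPinning
import HarnessLib

/-!
# Hagendorf–Liénardy's vector in the Temperley–Lieb gauge: our exchange relations, `K = 1`, Laurentness

Topic `Literature/Probability/Percolation`. The vector `Ψ` of `DiagonalStripVertexVector` (HL's
conventions) is transformed into the conventions of this development (IP12's system (20)–(22) with the
Temperley–Lieb generator `U` of the spin chain, `TemperleyLiebSpinChain`): with `ι` the inversion of all
rapidities and `g_σ = ∏_{σ_j = ↓} z_j⁻¹`, the vector **`Φ_σ = g_σ ι(Ψ_σ)`** (**`oursVec`**) satisfies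
* the **exchange relations** `[q z_t/z_s] Φ_σ - [z_s/z_t] (U_{s,t} Φ)_σ = [q z_s/z_t] σ_s Φ_σ` at every
  pair of adjacent sites (**`ours_exchange`**);
* the **reflection relations with trivial twist** `ι_L Φ_σ = Φ_σ`, `ι_1 Φ_σ = Φ_σ` (the diagonal
  `K`-matrices `K = 1`; **`genInv_last_oursVec`**, **`genInv_one_oursVec`**);
* **Laurentness**: `(∏_j z_j)^{2k} Φ_σ` is a polynomial in the squares of the rapidities as soon as
  `n - 1 ≤ k` and `L - n - 1 ≤ k` (**`oursVec_laurent`**); for `L = 2m+1`, `n = m` one can take `k = m`.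
The last point is proved along HL's recursion (Lemma 3.4): the move of a down spin one site to the
right reads `(z_s² - z_t²) Φ_{σ'} = [q] z_s² Φ_σ - (q z_s² - q⁻¹ z_t²) σ_s Φ_σ`, whose right side vanishes
at `z_s² = z_t²`, so no denominators are created; the special component is explicit.

## References

* C. Hagendorf, J. Liénardy, *The open XXZ chain at Δ = -1/2 and the boundary quantum
  Knizhnik–Zamolodchikov equations*, J. Stat. Mech. (2021) 013104, arXiv:2008.03220, §2.2, Prop. 3.2,
  Lemma 3.4, Props. 3.7–3.10. [HagendorfLienardy2021]
* Y. Ikhlef, A. K. Ponsaing, *Finite-size left-passage probability in percolation*, J. Stat. Phys. 149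
  (2012) 10–36, arXiv:1202.5476, §3.4 (20)–(22). [IkhlefPonsaing2012]
-/

noncomputable section

namespace Literature.Probability.Percolation

open Finset MvPolynomial Literature.Probability.LatticeModels.TemperleyLieb

variable {L n : ℕ}

/-! ### The gauge factor and the vector -/

section Gauge

variable (q : ℂ)

/-- The gauge factor `g_σ = ∏_{σ_j = ↓} z_j⁻¹`. [folklore] -/
def gDen (σ : SpinConfig L) : RapidityField ℂ := ∏ j ∈ downSet σ, (zv j)⁻¹

/-- **The vector in the Temperley–Lieb gauge**: `Φ_σ = g_σ ι(Ψ_σ)`, `ι` the inversion of all rapidities.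
[cite: HagendorfLienardy2021, §2.2] -/
def oursVec (L n : ℕ) (σ : SpinConfig L) : RapidityField ℂ := gDen σ * genInvAll ℂ L (vPsiVec q L n σ)

/-- The gauge factor is not zero. [folklore] -/
theorem gDen_ne_zero (σ : SpinConfig L) : gDen σ ≠ 0 := prod_ne_zero_iff.2 fun j _ => inv_ne_zero (zv_ne_zero j)

/-- The vector vanishes off the sector. [folklore] -/
theorem oursVec_of_ne {σ : SpinConfig L} (h : downCount σ ≠ n) : oursVec q L n σ = 0 := by
  rw [oursVec, vPsiVec_of_ne q h, map_zero, mul_zero]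

/-- `ι` inverts the site rapidities. [folklore] -/
theorem genInvAll_zv (j : Fin L) : genInvAll ℂ L (zv j) = (zv j)⁻¹ := by
  unfold zv; rw [genInvAll_genZ, if_pos ⟨by omega, j.isLt⟩]

/-- `ι` on the first bracket. [folklore] -/
theorem genInvAll_qbr_ratio (a b : Fin L) : genInvAll ℂ L (qbr (genC ℂ q * zv a / zv b)) = qbr (genC ℂ q * zv b / zv a) := by
  rw [genInvAll_qbr, map_div₀, map_mul, genInvAll_genC, genInvAll_zv, genInvAll_zv]
  congr 1; field_simp

/-- `ι` on the second bracket. [folklore] -/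
theorem genInvAll_qbr_ratio' (a b : Fin L) : genInvAll ℂ L (qbr (zv a / zv b)) = qbr (zv b / zv a) := by
  rw [genInvAll_qbr, map_div₀, genInvAll_zv, genInvAll_zv]
  congr 1; field_simp

/-- The down set after a move is the transported one. [folklore] -/
theorem downSet_spinFlip (s t : Fin L) (σ : SpinConfig L) : downSet (spinFlip s t σ) = (downSet σ).map (Equiv.swap s t).toEmbedding := by
  ext j
  simp only [mem_downSet, mem_map, Equiv.toEmbedding_apply]
  constructor
  · intro h
    refine ⟨Equiv.swap s t j, ?_, by rw [Equiv.swap_apply_self]⟩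
    by_cases h1 : j = s
    · subst h1
      by_cases hst : j = t
      · subst hst; rw [Equiv.swap_self, Equiv.refl_apply]; rwa [spinFlip_of_eq rfl] at h
      · rw [Equiv.swap_apply_left, ← spinFlip_apply_left hst σ]; exact h
    · by_cases h2 : j = t
      · subst h2; rw [Equiv.swap_apply_right, ← spinFlip_apply_right (a := s) σ]; exact h
      · rw [Equiv.swap_apply_of_ne_of_ne h1 h2, ← spinFlip_apply_of_ne h1 h2 σ]; exact h
  · rintro ⟨i, hi, rfl⟩
    by_cases h1 : i = s
    · subst h1
      by_cases hst : i = t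
      · subst hst; rw [Equiv.swap_self, Equiv.refl_apply, spinFlip_of_eq rfl]; exact hi
      · rw [Equiv.swap_apply_left, spinFlip_apply_right]; exact hi
    · by_cases h2 : i = t
      · subst h2; rw [Equiv.swap_apply_right, spinFlip_apply_left (Ne.symm h1)]; exact hi
      · rw [Equiv.swap_apply_of_ne_of_ne h1 h2, spinFlip_apply_of_ne h1 h2]; exact hi

/-- **The swap transports the gauge factor**: `σ_s g_σ = g_{σ^{(s t)}}`. [folklore] -/
theorem genSwap_gDen {s t : Fin L} (hst : t.val = s.val + 1) (σ : SpinConfig L) :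
    genSwap ℂ (s.val + 1) (gDen σ) = gDen (spinFlip s t σ) := by
  unfold gDen
  rw [map_prod, downSet_spinFlip, prod_map]
  refine prod_congr rfl fun j _ => ?_
  rw [map_inv₀, genSwap_zv hst]; rfl

/-- The gauge factors before and after a move: `g_{σ'} z_t = g_σ z_s`. [folklore] -/
theorem gDen_spinFlip_mul {s t : Fin L} {σ : SpinConfig L} (hs : σ s = true) (ht : σ t = false) :
    gDen (spinFlip s t σ) * zv t = gDen σ * zv s := by
  have hst : s ≠ t := fun h => by rw [h, ht] at hs; exact Bool.false_ne_true hs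
  have h1 : downSet (spinFlip s t σ) = insert t ((downSet σ).erase s) := by
    ext j
    simp only [mem_downSet, mem_insert, mem_erase]
    by_cases hjt : j = t
    · subst hjt; simp [spinFlip_apply_right, hs]
    · by_cases hjs : j = s
      · subst hjs; simp [spinFlip_apply_left hst, ht, hjt]
      · simp [spinFlip_apply_of_ne hjs hjt, hjt, hjs]
  have ht' : t ∉ (downSet σ).erase s := fun h => by
    have := mem_downSet.1 (mem_of_mem_erase h); rw [ht] at this; exact Bool.false_ne_true this
  unfold gDen
  rw [h1, prod_insert ht', ← mul_prod_erase (downSet σ) (fun j => (zv j)⁻¹) (mem_downSet.2 hs)]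
  have := zv_ne_zero s; have := zv_ne_zero t
  field_simp

end Gauge

/-! ### Our exchange relations -/

section Exchange

variable {q : ℂ} (hq : q ^ 2 + q + 1 = 0) {s t : Fin L} (hst : t.val = s.val + 1)
include hq hst

/-- **The exchange relations in the Temperley–Lieb gauge** (IP12 (21) on the spin chain):
`[q z_t/z_s] Φ_σ - [z_s/z_t] (U_{s,t} Φ)_σ = [q z_s/z_t] σ_s Φ_σ`. [cite: HagendorfLienardy2021, Prop. 3.2] -/
theorem ours_exchange (σ : SpinConfig L) :
    qbr (genC ℂ q * zv t / zv s) * oursVec q L n σ - qbr (zv s / zv t) * spinTL (genC ℂ q) s t (oursVec q L n) σ =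
      qbr (genC ℂ q * zv s / zv t) * genSwap ℂ (s.val + 1) (oursVec q L n σ) := by
  have hne : s ≠ t := fun h => by rw [h] at hst; omega
  have hsL : 1 ≤ s.val + 1 := by omega
  have htL : s.val + 1 + 1 ≤ L := by have := t.isLt; omega
  have hΨ := isHLExchange_vPsiVec (L := L) (n := n) hq hst
  have hc : genC ℂ q ≠ 0 := genC_ne_zero'' (ne_zero_of_quad hq)
  have hzs := zv_ne_zero s; have hzt := zv_ne_zero t
  set Ψ := vPsiVec q L n with hΨdef
  have hS : genSwap ℂ (s.val + 1) (oursVec q L n σ) = gDen (spinFlip s t σ) * genInvAll ℂ L (genSwap ℂ (s.val + 1) (Ψ σ)) := by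
    rw [oursVec, map_mul, genSwap_gDen hst, genInvAll_genSwap hsL htL]
  by_cases hσ : σ s = σ t
  · -- equal spins
    rw [spinTL_apply_of_eq _ _ _ hσ, mul_zero, sub_zero, hS, spinFlip_of_eq hσ, oursVec]
    have h1 := congrArg (genInvAll ℂ L) (hΨ.1 σ hσ)
    rw [map_mul, map_mul, genInvAll_qbr_ratio, genInvAll_qbr_ratio] at h1
    linear_combination gDen σ * h1.symm
  · rw [spinTL_apply_of_ne _ _ _ hσ, hS, oursVec, oursVec]
    have h2 := congrArg (genInvAll ℂ L) (hΨ.2 σ hσ)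
    rw [map_add, map_mul, map_mul, map_mul, genInvAll_qbr, genInvAll_genC, genInvAll_qbr_ratio', genInvAll_qbr_ratio] at h2
    set A := genInvAll ℂ L (Ψ σ)
    set B := genInvAll ℂ L (Ψ (spinFlip s t σ))
    set Sw := genInvAll ℂ L (genSwap ℂ (s.val + 1) (Ψ σ))
    cases hs : σ s
    · -- `σ_s = ↑`, `σ_t = ↓`
      have ht : σ t = true := by
        cases h' : σ t
        · exact absurd (hs.trans h'.symm) hσ
        · rfl
      have hg := gDen_spinFlip_mul (s := s) (t := t) (σ := spinFlip s t σ) (by rw [spinFlip_apply_left hne]; exact ht)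
        (by rw [spinFlip_apply_right]; exact hs)
      rw [spinFlip_spinFlip hne] at hg
      rw [if_neg Bool.false_ne_true]
      set G := gDen σ
      set G' := gDen (spinFlip s t σ)
      have hG : G = G' * zv s / zv t := by rw [← hg, mul_div_cancel_right₀ _ hzt]
      rw [hG]
      have key : (qbr (genC ℂ q * zv t / zv s) + (genC ℂ q)⁻¹ * qbr (zv s / zv t)) * zv s / zv t = qbr (genC ℂ q) := by
        unfold qbr; field_simp; ring
      have key2 : qbr (zv t / zv s) = -qbr (zv s / zv t) := by rw [← qbr_inv, inv_div]
      rw [key2] at h2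
      linear_combination (-G') * h2.symm + (G' * A) * key
    · -- `σ_s = ↓`, `σ_t = ↑`
      have ht : σ t = false := by
        cases h' : σ t
        · rfl
        · exact absurd (hs.trans h'.symm) hσ
      have hg := gDen_spinFlip_mul hs ht
      rw [if_pos rfl]
      set G := gDen σ
      set G' := gDen (spinFlip s t σ)
      have hG' : G' = G * zv s / zv t := by rw [← hg, mul_div_cancel_right₀ _ hzt]
      rw [hG']
      have key : qbr (genC ℂ q * zv t / zv s) + genC ℂ q * qbr (zv s / zv t) = qbr (genC ℂ q) * zv s / zv t := by
        unfold qbr; field_simp; ring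
      have key2 : qbr (zv t / zv s) = -qbr (zv s / zv t) := by rw [← qbr_inv, inv_div]
      rw [key2] at h2
      linear_combination (-(G * zv s / zv t)) * h2.symm + (G * A) * key

end Exchange

/-! ### The reflection relations: `K = 1` at both ends -/

section Reflection

variable {q : ℂ} (hq : q ^ 2 + q + 1 = 0)

/-- `genInv k` on the gauge factor: a factor `z_{k-1}²` if the site `k - 1` is down. [folklore] -/
theorem genInv_gDen {k : ℕ} (j₀ : Fin L) (hj₀ : j₀.val + 1 = k) (σ : SpinConfig L) :
    genInv ℂ k (gDen σ) = (if σ j₀ = true then zv j₀ ^ 2 else 1) * gDen σ := by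
  unfold gDen
  rw [map_prod]
  by_cases h : σ j₀ = true
  · rw [if_pos h, ← mul_prod_erase _ _ (mem_downSet.2 h), ← mul_prod_erase _ (fun j => (zv j)⁻¹) (mem_downSet.2 h), map_inv₀,
      genInv_zv_self' hj₀, inv_inv]
    have hfix : ∀ j ∈ (downSet σ).erase j₀, genInv ℂ k (zv j)⁻¹ = (zv j)⁻¹ := fun j hj => by
      rw [map_inv₀, genInv_zv_of_ne']
      intro h'; exact ne_of_mem_erase hj (Fin.ext (by omega))
    rw [prod_congr rfl hfix]
    have := zv_ne_zero j₀
    field_simp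
  · rw [if_neg h, one_mul]
    refine prod_congr rfl fun j hj => ?_
    rw [map_inv₀, genInv_zv_of_ne']
    intro h'
    have : j = j₀ := Fin.ext (by omega)
    rw [this] at hj; exact h (mem_downSet.1 hj)

include hq

/-- **The right reflection relation with `K = 1`**: `ι_L Φ_σ = Φ_σ` (sector `n = n'+1 ≤ L'`, `L = L'+1`
sites, `2 n' ≤ L'`). [cite: HagendorfLienardy2021, Prop. 3.7] -/
theorem genInv_last_oursVec {L' n' : ℕ} (h1 : n' + 1 ≤ L') (h2 : 2 * n' ≤ L') (σ : SpinConfig (L' + 1)) :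
    genInv ℂ (L' + 1) (oursVec q (L' + 1) (n' + 1) σ) = oursVec q (L' + 1) (n' + 1) σ := by
  by_cases hσ : downCount σ = n' + 1
  · rw [oursVec, map_mul, genInv_gDen (Fin.last L') (by simp) σ, genInv_genInvAll]
    by_cases hlast : σ (Fin.last L') = true
    · rw [if_pos hlast, genInv_vPsiVec_of_last_down hq h2 σ hσ hlast, map_mul, map_pow, genInvAll_zv]
      have := zv_ne_zero (Fin.last L')
      field_simp
    · rw [if_neg hlast, one_mul]
      have hup : σ ⟨L' + 1 - 1, by omega⟩ = false := by
        rw [show (⟨L' + 1 - 1, by omega⟩ : Fin (L' + 1)) = Fin.last L' from Fin.ext (by simp)]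
        cases h' : σ (Fin.last L')
        · rfl
        · exact absurd h' hlast
      rw [genInv_vPsiVec_of_last_up hq (by omega) σ hσ hup]
  · rw [oursVec_of_ne q hσ, map_zero]

/-- **The left reflection relation with `K = 1`**: `ι_1 Φ_σ = Φ_σ` (`1 ≤ n ≤ L'+1`, `L' ≤ 2n`).
[cite: HagendorfLienardy2021, Prop. 3.8] -/
theorem genInv_one_oursVec {L' : ℕ} (hn : 1 ≤ n) (hnL : n ≤ L' + 1) (hL : L' ≤ 2 * n) (σ : SpinConfig (L' + 1)) :
    genInv ℂ 1 (oursVec q (L' + 1) n σ) = oursVec q (L' + 1) n σ := by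
  by_cases hσ : downCount σ = n
  · rw [oursVec, map_mul, genInv_gDen (⟨0, by omega⟩ : Fin (L' + 1)) rfl σ, genInv_genInvAll,
      genInv_one_vPsiVec hq hn hnL hL σ hσ, map_mul]
    by_cases h0 : σ ⟨0, by omega⟩ = true
    · rw [if_pos h0, map_pow, genInvAll_zv]
      have := zv_ne_zero (⟨0, by omega⟩ : Fin (L' + 1))
      field_simp
    · rw [if_neg h0, map_one]; ring
  · rw [oursVec_of_ne q hσ, map_zero]

end Reflection

/-! ### The recursion along a move -/

section Recursion

variable {q : ℂ} (hq : q ^ 2 + q + 1 = 0) {s t : Fin L} (hst : t.val = s.val + 1)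
include hq hst

/-- **HL's recursion in the Temperley–Lieb gauge** (Lemma 3.4): moving a down spin from `s` to `t = s+1`,
`(z_s² - z_t²) Φ_{σ'} = [q] z_s² Φ_σ - (q z_s² - q⁻¹ z_t²) σ_s Φ_σ`. [cite: HagendorfLienardy2021, Lemma 3.4] -/
theorem ours_move {σ : SpinConfig L} (hs : σ s = true) (ht : σ t = false) :
    (zv s ^ 2 - zv t ^ 2) * oursVec q L n (spinFlip s t σ) =
      qbr (genC ℂ q) * zv s ^ 2 * oursVec q L n σ -
        (genC ℂ q * zv s ^ 2 - (genC ℂ q)⁻¹ * zv t ^ 2) * genSwap ℂ (s.val + 1) (oursVec q L n σ) := by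
  have h := ours_exchange (n := n) hq hst σ
  have hc : genC ℂ q ≠ 0 := genC_ne_zero'' (ne_zero_of_quad hq)
  have hzs := zv_ne_zero s; have hzt := zv_ne_zero t
  rw [spinTL_apply_of_ne _ _ _ (by rw [hs, ht]; decide), if_pos hs] at h
  unfold qbr at h ⊢
  field_simp at h
  field_simp
  linear_combination (-1 : RapidityField ℂ) * h

end Recursion

/-! ### Polynomials in the squares of the rapidities -/

section Squares

/-- The ring homomorphism `F ↦ F(z_1², z_2², …)` (constants to constants). [folklore] -/
def toRF2 : MvPolynomial ℕ ℂ →+* RapidityField ℂ := (toRF ℂ).comp (MvPolynomial.expand 2).toRingHom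

/-- `toRF2` on a variable. [folklore] -/
@[simp] theorem toRF2_X (k : ℕ) : toRF2 (X k) = genZ ℂ k ^ 2 := by
  simp [toRF2, MvPolynomial.expand_X, genZ]

/-- `toRF2` on a constant. [folklore] -/
@[simp] theorem toRF2_C (a : ℂ) : toRF2 (C a) = genC ℂ a := by
  simp [toRF2, genC]

/-- `toRF2` is `toRF ∘ expand 2`. [folklore] -/
theorem toRF2_apply (F : MvPolynomial ℕ ℂ) : toRF2 F = toRF ℂ (MvPolynomial.expand 2 F) := rfl

/-- The swap and `toRF2`. [folklore] -/
theorem genSwap_toRF2 (i : ℕ) (F : MvPolynomial ℕ ℂ) : genSwap ℂ i (toRF2 F) = toRF2 (rename (Equiv.swap i (i + 1)) F) := by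
  have : (genSwap ℂ i).toRingHom.comp toRF2 = toRF2.comp (rename (Equiv.swap i (i + 1))).toRingHom := by
    refine MvPolynomial.ringHom_ext (fun a => ?_) (fun k => ?_)
    · simp [genSwap_genC]
    · simp only [RingHom.comp_apply, RingEquiv.toRingHom_eq_coe, RingHom.coe_coe, toRF2_X, map_pow, genSwap_genZ,
        AlgHom.toRingHom_eq_coe, rename_X, zswap, Equiv.swap_apply_def]
      split_ifs <;> rfl
  exact congrArg (fun f => f F) (congrArg DFunLike.coe this)

/-- The substitution `X_a ↦ X_b` kills the difference of a polynomial and its `(a b)`-swap. [folklore] -/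
theorem substHom_rename_swap (a b : ℕ) (F : MvPolynomial ℕ ℂ) :
    substHom a (X b) (rename (Equiv.swap a b) F) = substHom a (X b) F := by
  have : (substHom a (X b : MvPolynomial ℕ ℂ)).comp (rename (Equiv.swap a b)) = substHom a (X b) := by
    refine MvPolynomial.algHom_ext fun k => ?_
    simp only [AlgHom.comp_apply, rename_X, Equiv.swap_apply_def]
    by_cases h1 : k = a
    · subst h1
      by_cases h2 : k = b
      · subst h2; simp
      · rw [if_pos rfl, substHom_X_of_ne _ (Ne.symm h2) , substHom_X_self]
    · by_cases h2 : k = b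
      · subst h2; rw [if_neg h1, if_pos rfl, substHom_X_self, substHom_X_of_ne _ h1]
      · rw [if_neg h1, if_neg h2]
  exact congrArg (fun f => f F) (congrArg DFunLike.coe this)

/-- **The Laurent step**: if `Π^{2k} Φ_σ = F(z²)` then `Π^{2k} Φ_{σ'} = H(z²)` for the moved configuration.
[cite: HagendorfLienardy2021, Lemma 3.9] -/
theorem laurent_step {q : ℂ} (hq : q ^ 2 + q + 1 = 0) {s t : Fin L} (hst : t.val = s.val + 1) {k : ℕ} {σ : SpinConfig L}
    (hs : σ s = true) (ht : σ t = false) {F : MvPolynomial ℕ ℂ} (hF : zvProd L ^ (2 * k) * oursVec q L n σ = toRF2 F) :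
    ∃ H : MvPolynomial ℕ ℂ, zvProd L ^ (2 * k) * oursVec q L n (spinFlip s t σ) = toRF2 H := by
  classical
  have hne : s ≠ t := fun h => by rw [h] at hst; omega
  -- the numerator polynomial (variables `a = s+1`, `a+1 = t+1`)
  set G : MvPolynomial ℕ ℂ := C (q - q⁻¹) * X (s.val + 1) * F -
    (C q * X (s.val + 1) - C q⁻¹ * X (s.val + 1 + 1)) * rename (Equiv.swap (s.val + 1) (s.val + 1 + 1)) F with hG
  have hmove := ours_move (n := n) hq hst hs ht
  have hzs2 : zv s ^ 2 = toRF2 (X (s.val + 1)) := by rw [toRF2_X]; rfl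
  have hzt2 : zv t ^ 2 = toRF2 (X (s.val + 1 + 1)) := by rw [toRF2_X, ← hst]; rfl
  have hPi : genSwap ℂ (s.val + 1) (zvProd L ^ (2 * k)) = zvProd L ^ (2 * k) := by rw [map_pow, genSwap_zvProd hst]
  have hSw : zvProd L ^ (2 * k) * genSwap ℂ (s.val + 1) (oursVec q L n σ) = toRF2 (rename (Equiv.swap (s.val + 1) (s.val + 1 + 1)) F) := by
    have := congrArg (genSwap ℂ (s.val + 1)) hF
    rw [map_mul, hPi, genSwap_toRF2] at this
    exact this
  have hnum : zvProd L ^ (2 * k) * oursVec q L n (spinFlip s t σ) * (zv s ^ 2 - zv t ^ 2) = toRF2 G := by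
    have e : zvProd L ^ (2 * k) * oursVec q L n (spinFlip s t σ) * (zv s ^ 2 - zv t ^ 2) =
        qbr (genC ℂ q) * zv s ^ 2 * (zvProd L ^ (2 * k) * oursVec q L n σ) -
          (genC ℂ q * zv s ^ 2 - (genC ℂ q)⁻¹ * zv t ^ 2) * (zvProd L ^ (2 * k) * genSwap ℂ (s.val + 1) (oursVec q L n σ)) := by
      linear_combination zvProd L ^ (2 * k) * hmove
    rw [e, hF, hSw, hG]
    have hCinv : genC ℂ q⁻¹ = (genC ℂ q)⁻¹ := by
      have hq0 := ne_zero_of_quad hq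
      refine (eq_inv_of_mul_eq_one_left ?_)
      unfold genC; rw [← map_mul, ← C_mul, inv_mul_cancel₀ hq0, C_1, map_one]
    simp only [map_sub, map_mul, toRF2_C, toRF2_X, qbr, hCinv]
    rw [hzs2, hzt2, toRF2_X, toRF2_X]
  -- divisibility by `X_a - X_{a+1}`
  have hdiv : (X (s.val + 1) - X (s.val + 1 + 1) : MvPolynomial ℕ ℂ) ∣ G := by
    refine X_sub_dvd_of_substHom_eq_zero ?_
    simp only [hG, map_sub, map_mul, substHom_rename_swap, substHom_C, substHom_X_self,
      substHom_X_of_ne (X (s.val + 1 + 1) : MvPolynomial ℕ ℂ) (show s.val + 1 + 1 ≠ s.val + 1 by omega)]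
    ring
  obtain ⟨H, hH⟩ := hdiv
  refine ⟨H, ?_⟩
  have hdiff : toRF2 (X (s.val + 1) - X (s.val + 1 + 1)) = zv s ^ 2 - zv t ^ 2 := by rw [map_sub, hzs2, hzt2]
  have hne0 : zv s ^ 2 - zv t ^ 2 ≠ 0 := by
    intro h
    apply qbr_zv_div_ne_zero (L := L) hne
    unfold qbr
    have hx : zv s / zv t ≠ 0 := div_ne_zero (zv_ne_zero s) (zv_ne_zero t)
    have hzt := zv_ne_zero t; have hzs := zv_ne_zero s
    rw [sub_eq_zero] at h
    field_simp
    linear_combination h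
  rw [hH, map_mul, hdiff] at hnum
  exact mul_right_cancel₀ hne0 (by rw [hnum]; ring)

end Squares

/-! ### The special component is Laurent -/

section Base

variable {q : ℂ} (hq : q ^ 2 + q + 1 = 0)

/-- **Double counting over pairs**: `∏_{a<b} f_a f_b = ∏_i f_i^{n-1}`. [folklore] -/
theorem prod_pairsLT_mul_eq_pow {M : Type*} [CommMonoid M] : ∀ (n : ℕ) (f : Fin n → M),
    ∏ p ∈ pairsLT n, f p.1 * f p.2 = ∏ i : Fin n, f i ^ (n - 1)
  | 0, f => by simp [pairsLT]
  | n + 1, f => by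
    rw [prod_pairsLT_succ (fun a b => f a * f b), prod_pairsLT_mul_eq_pow n (fun i => f i.castSucc), prod_mul_distrib,
      Fin.prod_univ_castSucc, prod_const, card_univ, Fintype.card_fin, Nat.add_sub_cancel]
    rcases Nat.eq_zero_or_pos n with rfl | hn
    · simp
    · obtain ⟨n', rfl⟩ : ∃ n', n = n' + 1 := ⟨n - 1, by omega⟩
      rw [Nat.add_sub_cancel, ← mul_assoc, ← prod_mul_distrib]
      simp_rw [← pow_succ]

/-- The down set of the packed configuration. [folklore] -/
theorem downSet_packed (L n : ℕ) : downSet (packed L n) = sLT L n := by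
  ext j; simp [packed, mem_sLT]

include hq

/-- The inverted special-component factor of the first kind is even with denominator `z_a² z_b²`. [folklore] -/
theorem genInvAll_specFactor (a b : Fin L) :
    genInvAll ℂ L (qbr (genC ℂ q * zv b / zv a) * qbr (genC ℂ q * zv a * zv b)) * (zv a ^ 2 * zv b ^ 2) =
      toRF2 (C (q⁻¹ ^ 2) * (C (q ^ 2) * X (a.val + 1) - X (b.val + 1)) * (C (q ^ 2) - X (a.val + 1) * X (b.val + 1))) := by
  have hq0 := ne_zero_of_quad hq
  have hc : genC ℂ q ≠ 0 := genC_ne_zero'' hq0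
  have ha := zv_ne_zero a; have hb := zv_ne_zero b
  have hCinv : genC ℂ q⁻¹ = (genC ℂ q)⁻¹ := by
    refine (eq_inv_of_mul_eq_one_left ?_)
    unfold genC; rw [← map_mul, ← C_mul, inv_mul_cancel₀ hq0, C_1, map_one]
  have hCpow : ∀ (x : ℂ) (k : ℕ), genC ℂ (x ^ k) = genC ℂ x ^ k := fun x k => by unfold genC; rw [C_pow, map_pow]
  rw [map_mul, genInvAll_qbr, genInvAll_qbr, map_div₀, map_mul, map_mul, map_mul, genInvAll_genC, genInvAll_zv, genInvAll_zv]
  simp only [map_mul, map_sub, toRF2_C, toRF2_X, hCpow, hCinv]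
  rw [show genZ ℂ (a.val + 1) = zv a from rfl, show genZ ℂ (b.val + 1) = zv b from rfl]
  unfold qbr
  field_simp

/-- The inverted special-component factor of the second kind is even with denominator `z_a² z_b²`. [folklore] -/
theorem genInvAll_prefFactor (a b : Fin L) :
    genInvAll ℂ L (qbr (genC ℂ q * zv b / zv a) * qbr (genC ℂ q ^ 2 * zv a * zv b)) * (zv a ^ 2 * zv b ^ 2) =
      toRF2 (C (q⁻¹ ^ 3) * (C (q ^ 2) * X (a.val + 1) - X (b.val + 1)) * (C (q ^ 4) - X (a.val + 1) * X (b.val + 1))) := by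
  have hq0 := ne_zero_of_quad hq
  have hc : genC ℂ q ≠ 0 := genC_ne_zero'' hq0
  have ha := zv_ne_zero a; have hb := zv_ne_zero b
  have hCinv : genC ℂ q⁻¹ = (genC ℂ q)⁻¹ := by
    refine (eq_inv_of_mul_eq_one_left ?_)
    unfold genC; rw [← map_mul, ← C_mul, inv_mul_cancel₀ hq0, C_1, map_one]
  have hCpow : ∀ (x : ℂ) (k : ℕ), genC ℂ (x ^ k) = genC ℂ x ^ k := fun x k => by unfold genC; rw [C_pow, map_pow]
  rw [map_mul, genInvAll_qbr, genInvAll_qbr, map_div₀, map_mul, map_mul, map_mul, map_pow, genInvAll_genC, genInvAll_zv,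
    genInvAll_zv]
  simp only [map_mul, map_sub, toRF2_C, toRF2_X, hCpow, hCinv]
  rw [show genZ ℂ (a.val + 1) = zv a from rfl, show genZ ℂ (b.val + 1) = zv b from rfl]
  unfold qbr
  field_simp

omit hq in
/-- A product of pair identities `x_p · d_p = y_p`: `(∏ x_p) · ∏ d_p = ∏ y_p`. [folklore] -/
theorem prod_mul_prod_eq {ι : Type*} (S : Finset ι) {x d y : ι → RapidityField ℂ} (h : ∀ p ∈ S, x p * d p = y p) :
    (∏ p ∈ S, x p) * ∏ p ∈ S, d p = ∏ p ∈ S, y p := by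
  rw [← prod_mul_distrib]; exact prod_congr rfl h

omit hq in
/-- The squared pair monomials over the first `n` sites. [folklore] -/
theorem prod_pairs_first_sq (hn : n ≤ L) :
    ∏ p ∈ (pairsLT L).filter (fun p => p.2.val < n), zv p.1 ^ 2 * zv p.2 ^ 2 = ∏ i ∈ sLT L n, (zv i ^ 2) ^ (n - 1) := by
  rw [← prod_pairsLT_castLE hn (fun a b => zv a ^ 2 * zv b ^ 2), prod_pairsLT_mul_eq_pow n (fun i => zv (Fin.castLE hn i) ^ 2),
    prod_castLE_eq_prod_sLT hn (fun i => (zv i ^ 2) ^ (n - 1))]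

omit hq in
/-- The squared pair monomials over the last `n' = L - n` sites. [folklore] -/
theorem prod_pairs_last_sq {n' : ℕ} (hnn : n + n' = L) :
    ∏ p ∈ (pairsLT L).filter (fun p => ¬p.1.val < n), zv p.1 ^ 2 * zv p.2 ^ 2 =
      ∏ j ∈ univ.filter (fun j : Fin L => ¬j.val < n), (zv j ^ 2) ^ (n' - 1) := by
  rw [← filter_snd_lt_rev hnn, ← prod_pairs_rev (fun p => p.2.val < n') (fun p => zv p.1 ^ 2 * zv p.2 ^ 2)]
  simp only [pairRev]
  rw [← prod_pairsLT_castLE (by omega : n' ≤ L) (fun a b => zv (Fin.rev b) ^ 2 * zv (Fin.rev a) ^ 2)]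
  have : ∏ p ∈ pairsLT n', zv (Fin.rev (Fin.castLE (by omega : n' ≤ L) p.2)) ^ 2 * zv (Fin.rev (Fin.castLE (by omega : n' ≤ L) p.1)) ^ 2 =
      ∏ p ∈ pairsLT n', zv (Fin.rev (Fin.castLE (by omega : n' ≤ L) p.1)) ^ 2 * zv (Fin.rev (Fin.castLE (by omega : n' ≤ L) p.2)) ^ 2 :=
    prod_congr rfl fun p _ => mul_comm _ _
  rw [this, prod_pairsLT_mul_eq_pow n' (fun i => zv (Fin.rev (Fin.castLE (by omega : n' ≤ L) i)) ^ 2),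
    prod_castLE_eq_prod_sLT (by omega : n' ≤ L) (fun i => (zv (Fin.rev i) ^ 2) ^ (n' - 1)),
    prod_sLT_rev hnn (fun j => (zv j ^ 2) ^ (n' - 1))]

/-- **The special component is Laurent**: `Π^{2k} Φ_{σ⁰} = F₀(z²)` for `n - 1 ≤ k`, `L - n - 1 ≤ k`.
[cite: HagendorfLienardy2021, Prop. 3.1, Prop. 3.10] -/
theorem oursVec_packed_laurent {k : ℕ} (hn : n ≤ L) (hk1 : n ≤ k + 1) (hk2 : L ≤ n + k + 1) :
    ∃ F : MvPolynomial ℕ ℂ, zvProd L ^ (2 * k) * oursVec q L n (packed L n) = toRF2 F := by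
  classical
  set n' := L - n with hn'
  have hnn : n + n' = L := by omega
  set F2 := (pairsLT L).filter (fun p => p.2.val < n) with hF2
  set G1 := (pairsLT L).filter (fun p => ¬p.1.val < n) with hG1
  set T := univ.filter (fun j : Fin L => ¬j.val < n) with hT
  -- the polynomial
  set N₁ : Fin L × Fin L → MvPolynomial ℕ ℂ := fun p =>
    C (q⁻¹ ^ 2) * (C (q ^ 2) * X (p.1.val + 1) - X (p.2.val + 1)) * (C (q ^ 2) - X (p.1.val + 1) * X (p.2.val + 1))
  set N₂ : Fin L × Fin L → MvPolynomial ℕ ℂ := fun p =>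
    C (q⁻¹ ^ 3) * (C (q ^ 2) * X (p.1.val + 1) - X (p.2.val + 1)) * (C (q ^ 4) - X (p.1.val + 1) * X (p.2.val + 1))
  set mono : MvPolynomial ℕ ℂ := (∏ i ∈ sLT L n, X (i.val + 1) ^ (k - (n - 1))) * ∏ j ∈ T, X (j.val + 1) ^ (k - (n' - 1))
  refine ⟨C ((-1) ^ n) * ((∏ p ∈ F2, N₁ p) * ∏ p ∈ G1, N₂ p) * mono, ?_⟩
  -- unfold the special component
  rw [oursVec, vPsiVec_packed q hn, vPsi_spec hq hn]
  unfold specRHS gDen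
  rw [downSet_packed, map_mul, map_mul, map_mul, map_pow, map_neg, map_one, map_prod, map_prod, map_prod]
  -- the three pair products
  have hP1 : (∏ p ∈ F2, genInvAll ℂ L (qbr (genC ℂ q * zv p.2 / zv p.1) * qbr (genC ℂ q * zv p.1 * zv p.2))) *
      ∏ p ∈ F2, zv p.1 ^ 2 * zv p.2 ^ 2 = ∏ p ∈ F2, toRF2 (N₁ p) :=
    prod_mul_prod_eq F2 fun p _ => genInvAll_specFactor hq p.1 p.2
  have hP2 : (∏ p ∈ G1, genInvAll ℂ L (qbr (genC ℂ q * zv p.2 / zv p.1) * qbr (genC ℂ q ^ 2 * zv p.1 * zv p.2))) *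
      ∏ p ∈ G1, zv p.1 ^ 2 * zv p.2 ^ 2 = ∏ p ∈ G1, toRF2 (N₂ p) :=
    prod_mul_prod_eq G1 fun p _ => genInvAll_prefFactor hq p.1 p.2
  have hZ : (∏ i ∈ sLT L n, (zv i)⁻¹) * ∏ i ∈ sLT L n, genInvAll ℂ L (zv i)⁻¹ = 1 := by
    rw [← prod_mul_distrib, prod_eq_one]
    intro i _
    rw [map_inv₀, genInvAll_zv, inv_inv, inv_mul_cancel₀ (zv_ne_zero i)]
  have hD1 := prod_pairs_first_sq (L := L) hn
  have hD2 := prod_pairs_last_sq (L := L) hnn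
  have hPi2 : zvProd L = (∏ i ∈ sLT L n, zv i) * ∏ j ∈ T, zv j := by
    unfold zvProd; rw [hT]; unfold sLT; rw [prod_filter_mul_prod_filter_not]
  -- the monomial
  have hmono : toRF2 mono * ((∏ i ∈ sLT L n, (zv i ^ 2) ^ (n - 1)) * ∏ j ∈ T, (zv j ^ 2) ^ (n' - 1)) = zvProd L ^ (2 * k) := by
    simp only [mono, map_mul, map_prod, map_pow, toRF2_X]
    rw [hPi2, mul_pow, ← prod_pow, ← prod_pow, mul_mul_mul_comm, ← prod_mul_distrib, ← prod_mul_distrib]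
    congr 1
    · refine prod_congr rfl fun i _ => ?_
      rw [show genZ ℂ (i.val + 1) = zv i from rfl, ← pow_mul, ← pow_mul, ← pow_add]
      congr 1; omega
    · refine prod_congr rfl fun j _ => ?_
      rw [show genZ ℂ (j.val + 1) = zv j from rfl, ← pow_mul, ← pow_mul, ← pow_add]
      congr 1; omega
  -- nonvanishing of the denominators
  have hd1 : ∏ p ∈ F2, zv p.1 ^ 2 * zv p.2 ^ 2 ≠ 0 :=
    prod_ne_zero_iff.2 fun p _ => mul_ne_zero (pow_ne_zero _ (zv_ne_zero _)) (pow_ne_zero _ (zv_ne_zero _))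
  have hd2 : ∏ p ∈ G1, zv p.1 ^ 2 * zv p.2 ^ 2 ≠ 0 :=
    prod_ne_zero_iff.2 fun p _ => mul_ne_zero (pow_ne_zero _ (zv_ne_zero _)) (pow_ne_zero _ (zv_ne_zero _))
  -- assemble
  rw [map_mul, map_mul, map_mul, toRF2_C, map_prod, map_prod, ← hP1, ← hP2, ← hmono, hD1, hD2]
  have hsign : genC ℂ ((-1) ^ n) = (-1) ^ n := by unfold genC; rw [map_pow, map_neg, C_1, map_pow, map_neg, map_one]
  rw [hsign]
  generalize ∏ p ∈ F2, genInvAll ℂ L (qbr (genC ℂ q * zv p.2 / zv p.1) * qbr (genC ℂ q * zv p.1 * zv p.2)) = A at *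
  generalize ∏ p ∈ G1, genInvAll ℂ L (qbr (genC ℂ q * zv p.2 / zv p.1) * qbr (genC ℂ q ^ 2 * zv p.1 * zv p.2)) = B at *
  generalize hZ1 : ∏ i ∈ sLT L n, (zv i)⁻¹ = Z₁ at *
  generalize hZ2 : ∏ i ∈ sLT L n, genInvAll ℂ L (zv i)⁻¹ = Z₂ at *
  generalize ∏ i ∈ sLT L n, (zv i ^ 2) ^ (n - 1) = D₁ at *
  generalize ∏ j ∈ T, (zv j ^ 2) ^ (n' - 1) = D₂ at *
  linear_combination (-1) ^ n * A * B * toRF2 mono * D₁ * D₂ * hZ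

end Base

/-! ### Laurentness on the whole sector -/

section Laurent

variable {q : ℂ} (hq : q ^ 2 + q + 1 = 0)
include hq

/-- **Laurentness** (HL Prop. 3.10 in our gauge): on the sector with `n` down spins, `Π^{2k} Φ_σ` is a
polynomial in the squares of the rapidities whenever `n - 1 ≤ k` and `L - n - 1 ≤ k`; in particular the
components of `Φ` are Laurent polynomials of degree `≥ -2k` in each rapidity.
[cite: HagendorfLienardy2021, Prop. 3.10] -/
theorem oursVec_laurent {k : ℕ} (hn : n ≤ L) (hk1 : n ≤ k + 1) (hk2 : L ≤ n + k + 1) (σ : SpinConfig L) :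
    ∃ F : MvPolynomial ℕ ℂ, zvProd L ^ (2 * k) * oursVec q L n σ = toRF2 F := by
  by_cases hσ : downCount σ = n
  · revert σ
    refine sector_induction (oursVec_packed_laurent hq hn hk1 hk2) ?_
    intro σ s t hst _ hs ht ih
    obtain ⟨F, hF⟩ := ih
    exact laurent_step hq hst hs ht hF
  · exact ⟨0, by rw [oursVec_of_ne q hσ, mul_zero, map_zero]⟩

/-- **The special component of `Φ` is not zero.** [folklore] -/
theorem oursVec_packed_ne_zero (hn : n ≤ L) : oursVec q L n (packed L n) ≠ 0 := by
  rw [oursVec, vPsiVec_packed q hn]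
  exact mul_ne_zero (gDen_ne_zero _) ((map_ne_zero_iff _ (genInvAll_injective L)).2 (vPsi_spec_ne_zero hq hn))

end Laurent

end Literature.Probability.Percolation
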